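import Mathlib
import Summits.AnomalousDissipation.AnomalousDissipation.Theorems.DyadicWallCascadeHalfSpaceHierarchyBandTools

/-!
# Stub `stub_slabOfBand` of the line `Sketch` — crux `DyadicWallCascade.HalfSpaceHierarchy`
# (item stmt-AnomalousDissipation-18627): a BAND profile is a SLAB profile

Sorry-free discharge of the registered stub `stub_slabOfBand` of the lead's skeleton (reshape v4,
`Cruxes/HalfSpaceHierarchy/Lines/Sketch.lean`).  A *band profile* asks for `(V, Q, F)` with `V, Q` smooth on the open
slab `1/2 < z < 4`, divergence free and steady Euler on the OPEN BAND `1 < z < 2` ONLY, the dilation relation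
`V (2X) = V X`, `Q (2X) = Q X` for `1/2 < z < 2`, `1`-periodicity in `x, y` for `1 ≤ z ≤ 2`, zero mass flux and energy
flux `F ≠ 0` through the unit square of `{z = 1}` — and NO bound clause.  The theorem upgrades it to a *slab profile*
(the hypothesis of the landed `stub_slabExtension`): Euler and zero divergence hold on the whole slab
(`stub_bandEulerTools`, file `…BandTools.lean`), and the bound `C` comes for free (`bandExt_bound`): by the dilation
relation every value of `(V, Q)` on the slab is a value on the closed band `1 ≤ z ≤ 2`, by integer periodicity
(`bandExt_periodic_int`, `bandExt_periodic_shift`) a value on the fundamental box `[0,1]² × [1,2]`, which is compact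
(`bandExt_isCompact_box`), where continuous functions are bounded.  So a construction line only has to solve steady
Euler in the open band and match smoothly across `z = 1, 2` (encoded as smoothness on the slab of the dilation-related
pair); `stub_slabExtension ∘ stub_slabOfBand` does the rest.  Folklore.
-/

-- `Summit.<Summit>.<Problem>` is the tree's mandated summit-side namespace (CONVENTIONS §2); for this
-- single-conjunct summit the two coincide, so the duplicate is deliberate.
set_option linter.dupNamespace false

open scoped Topology InnerProductSpace
open MeasureTheory Filter Set

noncomputable section

namespace Summit.AnomalousDissipation.AnomalousDissipation.Theorems.HalfSpaceHierarchy

/-! ### Horizontal periodicity: integer translates, reduction to the fundamental box -/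

/-- Unit periodicity on the band along a horizontal vector `v` gives periodicity by every integer multiple. -/
theorem bandExt_periodic_int {α : Type*} (f : EuclideanSpace ℝ (Fin 3) → α) (v : EuclideanSpace ℝ (Fin 3))
    (hv : v 2 = 0) (hper : ∀ X : EuclideanSpace ℝ (Fin 3), 1 ≤ X 2 → X 2 ≤ 2 → f (X + v) = f X) :
    ∀ (m : ℤ) (X : EuclideanSpace ℝ (Fin 3)), 1 ≤ X 2 → X 2 ≤ 2 → f (X + (m : ℝ) • v) = f X := by
  intro m
  induction m using Int.induction_on with
  | zero => intro X _ _; simp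
  | succ k ih =>
    intro X h1 h2
    push_cast at ih ⊢
    have hY1 : 1 ≤ (X + (k : ℝ) • v) 2 := by simpa [hv] using h1
    have hY2 : (X + (k : ℝ) • v) 2 ≤ 2 := by simpa [hv] using h2
    rw [add_smul, one_smul, ← add_assoc, hper _ hY1 hY2]
    exact ih X h1 h2
  | pred k ih =>
    intro X h1 h2
    push_cast at ih ⊢
    have hk : (-(k : ℝ) - 1) • v + v = (-(k : ℝ)) • v := by
      rw [sub_smul, one_smul, sub_add_cancel]
    have hY1 : 1 ≤ (X + (-(k : ℝ) - 1) • v) 2 := by simpa [hv] using h1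
    have hY2 : (X + (-(k : ℝ) - 1) • v) 2 ≤ 2 := by simpa [hv] using h2
    have h := hper _ hY1 hY2
    rw [add_assoc, hk] at h
    rw [← h]
    exact ih X h1 h2

/-- A band-periodic function takes at `X` the value it takes at the representative of `X` in the fundamental box
`[0,1) × [0,1) × [1,2]` (translate by `-⌊x⌋ e₀ - ⌊y⌋ e₁`). -/
theorem bandExt_periodic_shift {α : Type*} (f : EuclideanSpace ℝ (Fin 3) → α)
    (hper0 : ∀ X : EuclideanSpace ℝ (Fin 3), 1 ≤ X 2 → X 2 ≤ 2 →
      f (X + EuclideanSpace.single (0 : Fin 3) (1 : ℝ)) = f X)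
    (hper1 : ∀ X : EuclideanSpace ℝ (Fin 3), 1 ≤ X 2 → X 2 ≤ 2 →
      f (X + EuclideanSpace.single (1 : Fin 3) (1 : ℝ)) = f X)
    {X : EuclideanSpace ℝ (Fin 3)} (h1 : 1 ≤ X 2) (h2 : X 2 ≤ 2) :
    f X = f (X + ((-⌊X 0⌋ : ℤ) : ℝ) • EuclideanSpace.single (0 : Fin 3) (1 : ℝ)
      + ((-⌊X 1⌋ : ℤ) : ℝ) • EuclideanSpace.single (1 : Fin 3) (1 : ℝ)) := by
  have hz : (X + ((-⌊X 0⌋ : ℤ) : ℝ) • EuclideanSpace.single (0 : Fin 3) (1 : ℝ)) 2 = X 2 := by simp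
  rw [bandExt_periodic_int f _ (by simp) hper1 _ _ (by rw [hz]; exact h1) (by rw [hz]; exact h2),
    bandExt_periodic_int f _ (by simp) hper0 _ _ h1 h2]

/-- The representative lies in the fundamental box. -/
theorem bandExt_shift_mem_box (X : EuclideanSpace ℝ (Fin 3)) (h1 : 1 ≤ X 2) (h2 : X 2 ≤ 2) :
    (X + ((-⌊X 0⌋ : ℤ) : ℝ) • EuclideanSpace.single (0 : Fin 3) (1 : ℝ)
      + ((-⌊X 1⌋ : ℤ) : ℝ) • EuclideanSpace.single (1 : Fin 3) (1 : ℝ)) ∈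
    {Y : EuclideanSpace ℝ (Fin 3) | (0 ≤ Y 0 ∧ Y 0 ≤ 1) ∧ (0 ≤ Y 1 ∧ Y 1 ≤ 1) ∧ (1 ≤ Y 2 ∧ Y 2 ≤ 2)} := by
  have f0 := Int.fract_nonneg (X 0)
  have f0' := Int.fract_lt_one (X 0)
  have f1 := Int.fract_nonneg (X 1)
  have f1' := Int.fract_lt_one (X 1)
  rw [Int.fract] at f0 f0' f1 f1'
  have c0 : (X + ((-⌊X 0⌋ : ℤ) : ℝ) • EuclideanSpace.single (0 : Fin 3) (1 : ℝ)
      + ((-⌊X 1⌋ : ℤ) : ℝ) • EuclideanSpace.single (1 : Fin 3) (1 : ℝ)) 0 = X 0 - ⌊X 0⌋ := by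
    simp [sub_eq_add_neg]
  have c1 : (X + ((-⌊X 0⌋ : ℤ) : ℝ) • EuclideanSpace.single (0 : Fin 3) (1 : ℝ)
      + ((-⌊X 1⌋ : ℤ) : ℝ) • EuclideanSpace.single (1 : Fin 3) (1 : ℝ)) 1 = X 1 - ⌊X 1⌋ := by
    simp [sub_eq_add_neg]
  have c2 : (X + ((-⌊X 0⌋ : ℤ) : ℝ) • EuclideanSpace.single (0 : Fin 3) (1 : ℝ)
      + ((-⌊X 1⌋ : ℤ) : ℝ) • EuclideanSpace.single (1 : Fin 3) (1 : ℝ)) 2 = X 2 := by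
    simp
  simp only [mem_setOf_eq, c0, c1, c2]
  exact ⟨⟨f0, f0'.le⟩, ⟨f1, f1'.le⟩, h1, h2⟩

/-- The fundamental box `[0,1]² × [1,2]` is compact. -/
theorem bandExt_isCompact_box :
    IsCompact {Y : EuclideanSpace ℝ (Fin 3) | (0 ≤ Y 0 ∧ Y 0 ≤ 1) ∧ (0 ≤ Y 1 ∧ Y 1 ≤ 1) ∧ (1 ≤ Y 2 ∧ Y 2 ≤ 2)} := by
  have hc : ∀ i : Fin 3, Continuous fun Y : EuclideanSpace ℝ (Fin 3) => Y i :=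
    fun i => (continuous_apply i).comp (PiLp.continuous_ofLp 2 _)
  apply Metric.isCompact_of_isClosed_isBounded
  · simp only [Set.setOf_and]
    exact ((isClosed_le continuous_const (hc 0)).inter (isClosed_le (hc 0) continuous_const)).inter
      (((isClosed_le continuous_const (hc 1)).inter (isClosed_le (hc 1) continuous_const)).inter
        ((isClosed_le continuous_const (hc 2)).inter (isClosed_le (hc 2) continuous_const)))
  · rw [Metric.isBounded_iff_subset_closedBall (0 : EuclideanSpace ℝ (Fin 3))]
    refine ⟨3, fun Y hY => ?_⟩
    obtain ⟨⟨h00, h01⟩, ⟨h10, h11⟩, ⟨h20, h21⟩⟩ := hY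
    rw [Metric.mem_closedBall, dist_zero_right, EuclideanSpace.norm_eq]
    have hsum : ∑ i : Fin 3, ‖Y i‖ ^ 2 ≤ 3 ^ 2 := by
      simp only [Fin.sum_univ_three, Real.norm_eq_abs, sq_abs]
      nlinarith
    calc Real.sqrt (∑ i : Fin 3, ‖Y i‖ ^ 2) ≤ Real.sqrt (3 ^ 2) := Real.sqrt_le_sqrt hsum
      _ = 3 := Real.sqrt_sq (by norm_num)

/-- **Bounds for free.** A pair that is continuous on the slab, satisfies the dilation relation and is band-periodic
is bounded on the slab (reduce to the compact fundamental box). -/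
theorem bandExt_bound (V : EuclideanSpace ℝ (Fin 3) → EuclideanSpace ℝ (Fin 3)) (Q : EuclideanSpace ℝ (Fin 3) → ℝ)
    (hV : ContinuousOn V {Y : EuclideanSpace ℝ (Fin 3) | 1 / 2 < Y 2 ∧ Y 2 < 4}) (hQ : ContinuousOn Q {Y : EuclideanSpace ℝ (Fin 3) | 1 / 2 < Y 2 ∧ Y 2 < 4})
    (hdil : ∀ X : EuclideanSpace ℝ (Fin 3), 1 / 2 < X 2 → X 2 < 2 →
      V ((2 : ℝ) • X) = V X ∧ Q ((2 : ℝ) • X) = Q X)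
    (hper : ∀ X : EuclideanSpace ℝ (Fin 3), 1 ≤ X 2 → X 2 ≤ 2 →
      V (X + EuclideanSpace.single 0 (1 : ℝ)) = V X ∧ V (X + EuclideanSpace.single 1 (1 : ℝ)) = V X ∧
      Q (X + EuclideanSpace.single 0 (1 : ℝ)) = Q X ∧ Q (X + EuclideanSpace.single 1 (1 : ℝ)) = Q X) :
    ∃ C : ℝ, ∀ X ∈ {Y : EuclideanSpace ℝ (Fin 3) | 1 / 2 < Y 2 ∧ Y 2 < 4}, ‖V X‖ ≤ C ∧ |Q X| ≤ C := by
  set box : Set (EuclideanSpace ℝ (Fin 3)) :=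
    {Y | (0 ≤ Y 0 ∧ Y 0 ≤ 1) ∧ (0 ≤ Y 1 ∧ Y 1 ≤ 1) ∧ (1 ≤ Y 2 ∧ Y 2 ≤ 2)} with hbox
  have hsub : box ⊆ {Y : EuclideanSpace ℝ (Fin 3) | 1 / 2 < Y 2 ∧ Y 2 < 4} := by
    intro Y hY
    obtain ⟨-, -, h20, h21⟩ := hY
    exact ⟨by linarith, by linarith⟩
  obtain ⟨C₁, hC₁⟩ := bandExt_isCompact_box.exists_bound_of_continuousOn (hV.mono hsub)
  obtain ⟨C₂, hC₂⟩ := bandExt_isCompact_box.exists_bound_of_continuousOn (hQ.mono hsub)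
  refine ⟨max C₁ C₂, fun X hX => ?_⟩
  obtain ⟨h1, h4⟩ := hX
  -- step 1: a point of the closed band with the same values
  obtain ⟨X₁, hX₁1, hX₁2, hVX, hQX⟩ : ∃ X₁ : EuclideanSpace ℝ (Fin 3), 1 ≤ X₁ 2 ∧ X₁ 2 ≤ 2 ∧
      V X = V X₁ ∧ Q X = Q X₁ := by
    by_cases hlow : X 2 < 1
    · refine ⟨(2 : ℝ) • X, ?_, ?_, (hdil X h1 (by linarith)).1.symm, (hdil X h1 (by linarith)).2.symm⟩
      · simp only [PiLp.smul_apply, smul_eq_mul]; linarith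
      · simp only [PiLp.smul_apply, smul_eq_mul]; linarith
    · by_cases hhigh : X 2 ≤ 2
      · exact ⟨X, by linarith, hhigh, rfl, rfl⟩
      · push Not at hlow hhigh
        have hY1 : 1 / 2 < ((2 : ℝ)⁻¹ • X) 2 := by simp only [PiLp.smul_apply, smul_eq_mul]; linarith
        have hY2 : ((2 : ℝ)⁻¹ • X) 2 < 2 := by simp only [PiLp.smul_apply, smul_eq_mul]; linarith
        have h := hdil ((2 : ℝ)⁻¹ • X) hY1 hY2
        rw [smul_smul, mul_inv_cancel₀ two_ne_zero, one_smul] at h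
        refine ⟨(2 : ℝ)⁻¹ • X, ?_, ?_, h.1, h.2⟩
        · simp only [PiLp.smul_apply, smul_eq_mul]; linarith
        · simp only [PiLp.smul_apply, smul_eq_mul]; linarith
  -- step 2: reduce to the box
  have hV' := bandExt_periodic_shift V (fun Y a b => (hper Y a b).1) (fun Y a b => (hper Y a b).2.1) hX₁1 hX₁2
  have hQ' := bandExt_periodic_shift Q (fun Y a b => (hper Y a b).2.2.1) (fun Y a b => (hper Y a b).2.2.2) hX₁1 hX₁2
  have hmem := bandExt_shift_mem_box X₁ hX₁1 hX₁2
  constructor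
  · rw [hVX, hV']
    exact (hC₁ _ hmem).trans (le_max_left _ _)
  · rw [hQX, hQ', ← Real.norm_eq_abs]
    exact (hC₂ _ hmem).trans (le_max_right _ _)


/-- **Stub `stub_slabOfBand` (line `Sketch`, reshape v4; registered): a BAND profile is a SLAB profile.**  If `(V, Q)` are
smooth on the open slab `1/2 < z < 4`, divergence free and steady Euler on the OPEN BAND `1 < z < 2` only, satisfy
the dilation relation `V (2X) = V X`, `Q (2X) = Q X` for `1/2 < z < 2` and the band periodicity, then they are
divergence free and steady Euler on the whole slab (`bandExt_div_slab`, `bandExt_euler_slab`) and bounded there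
(`bandExt_bound`), i.e. they form a slab profile in the sense of `stub_slabProfile` / `stub_slabExtension`. -/
theorem stub_slabOfBand :
    (∃ (V : EuclideanSpace ℝ (Fin 3) → EuclideanSpace ℝ (Fin 3)) (Q : EuclideanSpace ℝ (Fin 3) → ℝ) (F : ℝ),
      ContDiffOn ℝ ((⊤ : ℕ∞) : WithTop ℕ∞) V {Y : EuclideanSpace ℝ (Fin 3) | 1 / 2 < Y 2 ∧ Y 2 < 4} ∧
      ContDiffOn ℝ ((⊤ : ℕ∞) : WithTop ℕ∞) Q {Y : EuclideanSpace ℝ (Fin 3) | 1 / 2 < Y 2 ∧ Y 2 < 4} ∧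
      (∀ X : EuclideanSpace ℝ (Fin 3), 1 < X 2 → X 2 < 2 →
        ∑ i : Fin 3, (fderiv ℝ V X (EuclideanSpace.single i (1 : ℝ))) i = 0) ∧
      (∀ X : EuclideanSpace ℝ (Fin 3), 1 < X 2 → X 2 < 2 → (fderiv ℝ V X) (V X) + gradient Q X = 0) ∧
      (∀ X : EuclideanSpace ℝ (Fin 3), 1 / 2 < X 2 → X 2 < 2 → V ((2 : ℝ) • X) = V X ∧ Q ((2 : ℝ) • X) = Q X) ∧
      (∀ X : EuclideanSpace ℝ (Fin 3), 1 ≤ X 2 → X 2 ≤ 2 →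
        V (X + EuclideanSpace.single 0 (1 : ℝ)) = V X ∧ V (X + EuclideanSpace.single 1 (1 : ℝ)) = V X ∧
        Q (X + EuclideanSpace.single 0 (1 : ℝ)) = Q X ∧ Q (X + EuclideanSpace.single 1 (1 : ℝ)) = Q X) ∧
      (∫ q in Set.Icc (0 : ℝ) 1 ×ˢ Set.Icc (0 : ℝ) 1, (V !₂[q.1, q.2, (1 : ℝ)]) 2 = 0) ∧ F ≠ 0 ∧
      (∫ q in Set.Icc (0 : ℝ) 1 ×ˢ Set.Icc (0 : ℝ) 1,
        (V !₂[q.1, q.2, (1 : ℝ)]) 2 * (‖V !₂[q.1, q.2, (1 : ℝ)]‖ ^ 2 / 2 + Q !₂[q.1, q.2, (1 : ℝ)]) = F)) →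
    ∃ (V : EuclideanSpace ℝ (Fin 3) → EuclideanSpace ℝ (Fin 3)) (Q : EuclideanSpace ℝ (Fin 3) → ℝ) (C F : ℝ),
      ContDiffOn ℝ ((⊤ : ℕ∞) : WithTop ℕ∞) V {Y : EuclideanSpace ℝ (Fin 3) | 1 / 2 < Y 2 ∧ Y 2 < 4} ∧
      ContDiffOn ℝ ((⊤ : ℕ∞) : WithTop ℕ∞) Q {Y : EuclideanSpace ℝ (Fin 3) | 1 / 2 < Y 2 ∧ Y 2 < 4} ∧
      (∀ X ∈ {Y : EuclideanSpace ℝ (Fin 3) | 1 / 2 < Y 2 ∧ Y 2 < 4}, ‖V X‖ ≤ C ∧ |Q X| ≤ C) ∧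
      (∀ X ∈ {Y : EuclideanSpace ℝ (Fin 3) | 1 / 2 < Y 2 ∧ Y 2 < 4},
        ∑ i : Fin 3, (fderiv ℝ V X (EuclideanSpace.single i (1 : ℝ))) i = 0) ∧
      (∀ X ∈ {Y : EuclideanSpace ℝ (Fin 3) | 1 / 2 < Y 2 ∧ Y 2 < 4}, (fderiv ℝ V X) (V X) + gradient Q X = 0) ∧
      (∀ X : EuclideanSpace ℝ (Fin 3), 1 / 2 < X 2 → X 2 < 2 → V ((2 : ℝ) • X) = V X ∧ Q ((2 : ℝ) • X) = Q X) ∧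
      (∀ X : EuclideanSpace ℝ (Fin 3), 1 ≤ X 2 → X 2 ≤ 2 →
        V (X + EuclideanSpace.single 0 (1 : ℝ)) = V X ∧ V (X + EuclideanSpace.single 1 (1 : ℝ)) = V X ∧
        Q (X + EuclideanSpace.single 0 (1 : ℝ)) = Q X ∧ Q (X + EuclideanSpace.single 1 (1 : ℝ)) = Q X) ∧
      (∫ q in Set.Icc (0 : ℝ) 1 ×ˢ Set.Icc (0 : ℝ) 1, (V !₂[q.1, q.2, (1 : ℝ)]) 2 = 0) ∧ F ≠ 0 ∧
      (∫ q in Set.Icc (0 : ℝ) 1 ×ˢ Set.Icc (0 : ℝ) 1,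
        (V !₂[q.1, q.2, (1 : ℝ)]) 2 * (‖V !₂[q.1, q.2, (1 : ℝ)]‖ ^ 2 / 2 + Q !₂[q.1, q.2, (1 : ℝ)]) = F) := by
  rintro ⟨V, Q, F, hV, hQ, hdiv, hE, hdil, hper, hmass, hF, hflux⟩
  obtain ⟨C, hC⟩ := bandExt_bound V Q hV.continuousOn hQ.continuousOn hdil hper
  exact ⟨V, Q, C, F, hV, hQ, hC, bandExt_div_slab V hV (fun Y a b => (hdil Y a b).1) hdiv,
    bandExt_euler_slab V Q hV hQ hdil hE, hdil, hper, hmass, hF, hflux⟩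

end Summit.AnomalousDissipation.AnomalousDissipation.Theorems.HalfSpaceHierarchy

end
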